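import Literature.Computability.AlgebraicComplexity.BCMV25PermanentalVarieties
import HarnessLib

/-!
# Laubenbacher–Swanson 2000: the ideal of `2 × 2` permanents of a generic matrix
# (Lemma 2.1, Theorem 4.1 first half, and its height)

Topic `Literature/Computability/AlgebraicComplexity`; theorem-only file (no definitions, no named
facts).  Source: R. C. Laubenbacher, I. Swanson, *Permanental ideals*, J. Symbolic Comput. 30
(2000) 195–205, arXiv:math/9812112 (held, text p0001–p0008).  Standing hypothesis of the paper
(p0002 L42–46): `F` a field of characteristic `≠ 2`; `M = (x_{ij})` the generic `m × n` matrix,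
`P₂(M)` the ideal of its `2 × 2` subpermanents — the tree's
`BoraleviCarliniMichalekVentura2025.subpermIdeal F m n 2`.

## What is typed

* `pair_mem_subpermIdeal_two`, `two_mul_rowTriple_mem`, `two_mul_colTriple_mem` (every
  commutative ring) and `lemma_2_1_rows`, `lemma_2_1_cols` (`2` a unit) — **Lemma 2.1** (p0003
  L10–35): `P₂(M)` contains all products of three entries taken from two rows and three
  distinct columns, or three rows and two columns; typed through the explicit identity
  `2·x_{ri} x_{rj} x_{sk} = x_{ri}·per + x_{rj}·per − x_{rk}·per` of the printed proof
  ("`c(ay+bx) − a(bz+cy) = b(cx − az)` … and `2` is a unit in `R`").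
* `support_trichotomy` — **Theorem 4.1, first half, at a point**: an `m × n` matrix over a
  domain in which `2 ≠ 0` all of whose `2 × 2` permanents vanish is supported in one row, or in
  one column, or in one `2 × 2` block (LS p0006 L24–60: "We first show that `P` contains all the
  entries from some row or from some column of `M` …", with the same case analysis: rows with
  at most one entry off `P`, else a row with two entries off `P` and Lemma 2.1).
* `thm_4_1_contains` — **Theorem 4.1, first half** (p0006 L9–22: "Each of the prime ideals `P`
  of `R` minimal over `P₂(M)` is one of the following: (1) … generated by all the indeterminates
  in `m−1` of the rows of `M`; (2) … in `n−1` of the columns of `M`; (3) … generated by the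
  permanent of one `2 × 2`-submatrix of `M` and all the entries of `M` outside of this
  submatrix"), in the form: every prime `P ⊇ P₂(M)` CONTAINS an ideal of type (1), (2) or (3)
  (explicit index data: the row `r` / the column `c` / the block `(r, s; c, d)` and its
  permanent).
* `rem_4_2_rows`, `rem_4_2_cols` — **Remark 4.2** (p0006 L107–112) for the types (1), (2): the
  ideal of the variables off a row / a column has height exactly `(m−1)n` / `m(n−1)` (variable
  spans: Krull above, vanishing coordinates at the generic point below); `rem_4_2_block_ge` —
  type (3) as a LOWER bound only: every prime containing the variables off a `2 × 2` block and
  the block permanent has height `≥ mn − 3` (`blockStep_height_ge`: `mn − 4` vanishing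
  coordinates and one strict chain step for the permanent).
* `height_ker_aeval_ge_of_twoSubperm`, `height_ge_of_subpermIdeal_two_le`,
  `height_subpermIdeal_two_le_rows`, `height_subpermIdeal_two_le_cols` and the MAIN theorem
  `height_subpermIdeal_two`: for `m, n ≥ 2` with `max(m,n) ≥ 3` and `2 ≠ 0` in `F`,
  `ht P₂(M) = mn − max(m, n)` — the least of the three heights `(m−1)n`, `m(n−1)`, `mn − 3` of
  Remark 4.2 (`min = mn − max(m,n)` exactly when `max(m,n) ≥ 3`; the excluded `2 × 2` case is
  principal of height `1 = mn − 3`), which enter as lower bounds at the generic point of a prime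
  through the support trichotomy, the upper bound being the row / column type ideals.  The two
  instances already in the tree are re-derived in ≤ 5 lines each (`thm_2_1_height_of_LS`:
  `m = 2`, `ht = n`, = `BoraleviCarliniMichalekVentura2025.thm_2_1_height`;
  `height_subpermIdeal_three_three_two_of_LS`: `3 × 3`, `ht = 6`,
  = `BoraleviCarliniMichalekVentura2025.height_subpermIdeal_three_three_two` of file
  `ABV17SingPermThreeCodim`); the landed files are not touched.

## What is NOT typed

* Lemma 2.2, §3 (Gröbner bases, Theorems 3.1–3.3), the second half of Theorem 4.1 ("Moreover,
  each of the primes in (1), (2) and (3) is minimal over `P₂(M)`"), the exact height `mn − 3` and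
  primality of the type (3) ideals (Remark 4.2), Corollaries 4.3–4.4 (non-equidimensionality,
  number of components), §5 (primary decomposition, radical, integral closure).

Honest framing: V0 dictionary (commutative algebra of `P₂(M)`, the [LS2000] input quoted by
Boralevi–Carlini–Michałek–Ventura 2025, Thm. 2.1); no rung of any route moves; VP ≠ VNP is NOT
proved.

## References

* R. C. Laubenbacher, I. Swanson, *Permanental ideals*, J. Symbolic Comput. 30 (2000) 195–205,
  arXiv:math/9812112: Lemma 2.1 (p0003 L10–35), Thm. 4.1 (p0006 L9–22), Rem. 4.2 (p0006
  L106–112). [LaubenbacherSwanson2000]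
* A. Boralevi, E. Carlini, M. Michałek, E. Ventura, *On the codimension of permanental
  varieties*, Adv. Math. 461 (2025), arXiv:2402.17839: Thm. 2.1 and its proof ([LS2000]).
  [BoraleviCarliniMichalekVentura2025]
-/

noncomputable section

open Matrix MvPolynomial Finset

namespace Literature.Computability.AlgebraicComplexity

namespace LaubenbacherSwanson2000

open VonZurGathen BoraleviCarliniMichalekVentura2025

/-! ### §A. Lemma 2.1: monomials in `P₂(M)` -/

section Lemma21

variable (F : Type*) [CommRing F] {m n : ℕ}

/-- The `2 × 2` permanent of the generic matrix on rows `{r, s}` and columns `{i, j}`, written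
out, lies in `P₂(M)`. [cite: LaubenbacherSwanson2000, §1 (definition of `P_r(M)`, arXiv text p0002 L36–41)] -/
theorem pair_mem_subpermIdeal_two {r s : Fin m} {i j : Fin n} (hrs : r ≠ s) (hij : i ≠ j) :
    (X (r, i) * X (s, j) + X (r, j) * X (s, i) : MvPolynomial (Fin m × Fin n) F) ∈
      subpermIdeal F m n 2 := by
  classical
  have h := rsubperm_mem_subpermIdeal (F := F) (Finset.card_pair hrs) (Finset.card_pair hij)
  rw [rsubperm_pair _ hrs hij] at h
  simpa only [Matrix.mvPolynomialX_apply] using h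

/-- **Lemma 2.1, two rows and three columns, over every commutative ring**: for `r ≠ s` and
distinct columns `i, j, k`, `2 · x_{ri} x_{rj} x_{sk} ∈ P₂(M)`, by the identity
`2 x_{ri} x_{rj} x_{sk} = x_{ri}·per[rs|jk] + x_{rj}·per[rs|ik] − x_{rk}·per[rs|ij]` (LS:
"`c(ay + bx) − a(bz + cy) = b(cx − az)` … since `cx + az ∈ P₂(M)`").
[cite: LaubenbacherSwanson2000, Lemma 2.1 (arXiv text p0003 L10–35)] -/
theorem two_mul_rowTriple_mem {r s : Fin m} {i j k : Fin n} (hrs : r ≠ s) (hij : i ≠ j)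
    (hik : i ≠ k) (hjk : j ≠ k) :
    (2 * (X (r, i) * X (r, j) * X (s, k)) : MvPolynomial (Fin m × Fin n) F) ∈
      subpermIdeal F m n 2 := by
  have e : (2 * (X (r, i) * X (r, j) * X (s, k)) : MvPolynomial (Fin m × Fin n) F) =
      X (r, i) * (X (r, j) * X (s, k) + X (r, k) * X (s, j)) +
        X (r, j) * (X (r, i) * X (s, k) + X (r, k) * X (s, i)) -
        X (r, k) * (X (r, i) * X (s, j) + X (r, j) * X (s, i)) := by ring
  rw [e]
  exact Ideal.sub_mem _
    (Ideal.add_mem _ (Ideal.mul_mem_left _ _ (pair_mem_subpermIdeal_two F hrs hjk))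
      (Ideal.mul_mem_left _ _ (pair_mem_subpermIdeal_two F hrs hik)))
    (Ideal.mul_mem_left _ _ (pair_mem_subpermIdeal_two F hrs hij))

/-- **Lemma 2.1, three rows and two columns, over every commutative ring**: for distinct rows
`r, s, t` and `i ≠ j`, `2 · x_{ri} x_{si} x_{tj} ∈ P₂(M)`
(`= x_{ri}·per[st|ij] + x_{si}·per[rt|ij] − x_{ti}·per[rs|ij]`).
[cite: LaubenbacherSwanson2000, Lemma 2.1 (arXiv text p0003 L10–35)] -/
theorem two_mul_colTriple_mem {r s t : Fin m} {i j : Fin n} (hrs : r ≠ s) (hrt : r ≠ t)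
    (hst : s ≠ t) (hij : i ≠ j) :
    (2 * (X (r, i) * X (s, i) * X (t, j)) : MvPolynomial (Fin m × Fin n) F) ∈
      subpermIdeal F m n 2 := by
  have e : (2 * (X (r, i) * X (s, i) * X (t, j)) : MvPolynomial (Fin m × Fin n) F) =
      X (r, i) * (X (s, i) * X (t, j) + X (s, j) * X (t, i)) +
        X (s, i) * (X (r, i) * X (t, j) + X (r, j) * X (t, i)) -
        X (t, i) * (X (r, i) * X (s, j) + X (r, j) * X (s, i)) := by ring
  rw [e]
  exact Ideal.sub_mem _
    (Ideal.add_mem _ (Ideal.mul_mem_left _ _ (pair_mem_subpermIdeal_two F hst hij))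
      (Ideal.mul_mem_left _ _ (pair_mem_subpermIdeal_two F hrt hij)))
    (Ideal.mul_mem_left _ _ (pair_mem_subpermIdeal_two F hrs hij))

variable {F}

/-- **Laubenbacher–Swanson 2000, Lemma 2.1 (rows)** ("The ideal `P₂(M)` contains all products of
three entries of `M`, taken from three distinct columns and two distinct rows"), for a
commutative ring in which `2` is a unit (the paper: a field of characteristic `≠ 2`).
[cite: LaubenbacherSwanson2000, Lemma 2.1 (arXiv text p0003 L10–35)] -/
theorem lemma_2_1_rows (h2 : IsUnit (2 : F)) {r s : Fin m} {i j k : Fin n} (hrs : r ≠ s)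
    (hij : i ≠ j) (hik : i ≠ k) (hjk : j ≠ k) :
    (X (r, i) * X (r, j) * X (s, k) : MvPolynomial (Fin m × Fin n) F) ∈ subpermIdeal F m n 2 := by
  obtain ⟨u, hu⟩ := h2
  have h := Ideal.mul_mem_left _ (C (↑u⁻¹ : F)) (two_mul_rowTriple_mem F hrs hij hik hjk)
  rwa [← mul_assoc, show (C (↑u⁻¹ : F) * 2 : MvPolynomial (Fin m × Fin n) F) = 1 by
    rw [← map_ofNat C, ← map_mul, ← hu, Units.inv_mul, map_one], one_mul] at h

/-- **Laubenbacher–Swanson 2000, Lemma 2.1 (columns)** ("… or from two distinct columns and three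
distinct rows"), `2` a unit. [cite: LaubenbacherSwanson2000, Lemma 2.1 (arXiv text p0003 L10–35)] -/
theorem lemma_2_1_cols (h2 : IsUnit (2 : F)) {r s t : Fin m} {i j : Fin n} (hrs : r ≠ s)
    (hrt : r ≠ t) (hst : s ≠ t) (hij : i ≠ j) :
    (X (r, i) * X (s, i) * X (t, j) : MvPolynomial (Fin m × Fin n) F) ∈ subpermIdeal F m n 2 := by
  obtain ⟨u, hu⟩ := h2
  have h := Ideal.mul_mem_left _ (C (↑u⁻¹ : F)) (two_mul_colTriple_mem F hrs hrt hst hij)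
  rwa [← mul_assoc, show (C (↑u⁻¹ : F) * 2 : MvPolynomial (Fin m × Fin n) F) = 1 by
    rw [← map_ofNat C, ← map_mul, ← hu, Units.inv_mul, map_one], one_mul] at h

end Lemma21

/-! ### §B. Theorem 4.1, first half, at a point: the support trichotomy -/

section Pointwise

variable {L : Type*} [CommRing L] [IsDomain L]

/-- **Theorem 4.1 (first half) at a point — support trichotomy**: let `a` be an `m × n` matrix
(`m, n ≥ 1`) over a domain in which `2 ≠ 0`, all of whose `2 × 2` permanents
`a_{ri} a_{sj} + a_{rj} a_{si}` (`r ≠ s`, `i ≠ j`) vanish.  Then the support of `a` lies in one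
row, or in one column, or in a `2 × 2` block `{r, s} × {c, d}` (with `a_{rc} ≠ 0`).  This is the
case analysis of LS's proof ("If `P` contains all but one entry from each row … there exists a
`2 × 2`-submatrix … contradiction, since `P` is prime.  So, necessarily, there is a row of `M`
which has two entries not in `P`, say `x₁₁, x₁₂ ∉ P`.  By Lemma 2.1, `x₁₁ x₁₂ x_{ij} ∈ P` for all
`i > 1, j > 2` …"): two rows with a common live column `c` contradict `2 ≠ 0`
(`a_{rc}(a_{sc} a_{td} + a_{sd} a_{tc}) = −2 a_{rd} a_{sc} a_{tc}`).
[cite: LaubenbacherSwanson2000, Thm. 4.1, proof (arXiv text p0006 L24–60)] -/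
theorem support_trichotomy (h2 : (2 : L) ≠ 0) {m n : ℕ} (hm : 1 ≤ m) (hn : 1 ≤ n)
    (a : Fin m × Fin n → L)
    (hvan : ∀ (r s : Fin m) (i j : Fin n), r ≠ s → i ≠ j →
      a (r, i) * a (s, j) + a (r, j) * a (s, i) = 0) :
    (∃ r : Fin m, ∀ s j, s ≠ r → a (s, j) = 0) ∨
    (∃ c : Fin n, ∀ i d, d ≠ c → a (i, d) = 0) ∨
    (∃ (r s : Fin m) (c d : Fin n), r ≠ s ∧ c ≠ d ∧ a (r, c) ≠ 0 ∧
      ∀ i j, a (i, j) ≠ 0 → (i = r ∨ i = s) ∧ (j = c ∨ j = d)) := by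
  classical
  by_cases h1 : ∀ r : Fin m, ∃ c : Fin n, ∀ j, j ≠ c → a (r, j) = 0
  · -- every row has at most one nonzero entry: all nonzero entries lie in one column
    by_cases h0 : ∀ x, a x = 0
    · exact Or.inl ⟨⟨0, hm⟩, fun s j _ => h0 (s, j)⟩
    push Not at h0
    obtain ⟨⟨i₀, j₀⟩, hij₀⟩ := h0
    refine Or.inr (Or.inl ⟨j₀, fun i d hd => ?_⟩)
    by_contra hid
    obtain ⟨ci, hci⟩ := h1 i
    obtain ⟨c₀, hc₀⟩ := h1 i₀
    have hcid : ci = d := by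
      by_contra h
      exact hid (hci d (Ne.symm h))
    have hij₀' : a (i, j₀) = 0 := hci j₀ (by rw [hcid]; exact Ne.symm hd)
    have hc₀j : c₀ = j₀ := by
      by_contra h
      exact hij₀ (hc₀ j₀ (Ne.symm h))
    have hi₀d : a (i₀, d) = 0 := hc₀ d (by rw [hc₀j]; exact hd)
    have hii : i₀ ≠ i := fun h => hid (by rw [← h]; exact hi₀d)
    have h := hvan i₀ i j₀ d hii (Ne.symm hd)
    rw [hi₀d, zero_mul, add_zero] at h
    exact (mul_ne_zero hij₀ hid) h
  · push Not at h1
    obtain ⟨r, hr⟩ := h1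
    obtain ⟨c, -, hc⟩ := hr ⟨0, hn⟩
    obtain ⟨d, hdc, hd⟩ := hr c
    -- `a_{rc} ≠ 0`, `a_{rd} ≠ 0`, `d ≠ c`
    have rowA : ∀ s, s ≠ r → a (s, c) = 0 → ∀ j, a (s, j) = 0 := by
      intro s hsr hsc j
      by_cases hjc : j = c
      · rw [hjc]; exact hsc
      · have h := hvan r s c j (Ne.symm hsr) (Ne.symm hjc)
        rw [hsc, mul_zero, add_zero] at h
        exact (mul_eq_zero.1 h).resolve_left hc
    have rowB : ∀ s, s ≠ r → a (s, c) ≠ 0 → ∀ j, j ≠ c → j ≠ d →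
        a (r, j) = 0 ∧ a (s, j) = 0 := by
      intro s hsr hsc j hjc hjd
      have hj := hvan r s c j (Ne.symm hsr) (Ne.symm hjc)
      have hdrel := hvan r s c d (Ne.symm hsr) (Ne.symm hdc)
      have hdj := hvan r s d j (Ne.symm hsr) (Ne.symm hjd)
      have key : a (r, c) * (a (r, d) * a (s, j) + a (r, j) * a (s, d)) =
          -(2 * (a (r, d) * a (r, j)) * a (s, c)) := by
        have e1 : a (r, c) * a (s, j) = -(a (r, j) * a (s, c)) := eq_neg_of_add_eq_zero_left hj
        have e2 : a (r, c) * a (s, d) = -(a (r, d) * a (s, c)) :=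
          eq_neg_of_add_eq_zero_left hdrel
        linear_combination a (r, d) * e1 + a (r, j) * e2
      rw [hdj, mul_zero] at key
      have h0 : 2 * (a (r, d) * a (r, j)) * a (s, c) = 0 := neg_eq_zero.1 key.symm
      have hrj : a (r, j) = 0 := by
        rcases mul_eq_zero.1 h0 with h | h
        · rcases mul_eq_zero.1 h with h' | h'
          · exact absurd h' h2
          · exact (mul_eq_zero.1 h').resolve_left hd
        · exact absurd h hsc
      refine ⟨hrj, ?_⟩
      rw [hrj, zero_mul, add_zero] at hj
      exact (mul_eq_zero.1 hj).resolve_left hc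
    have twoLive : ∀ s t, s ≠ r → t ≠ r → s ≠ t → a (s, c) ≠ 0 → a (t, c) ≠ 0 → False := by
      intro s t hsr htr hst hsc htc
      have hs := hvan r s c d (Ne.symm hsr) (Ne.symm hdc)
      have ht := hvan r t c d (Ne.symm htr) (Ne.symm hdc)
      have hst' := hvan s t c d hst (Ne.symm hdc)
      have key : a (r, c) * (a (s, c) * a (t, d) + a (s, d) * a (t, c)) =
          -(2 * (a (r, d) * a (s, c)) * a (t, c)) := by
        have e1 : a (r, c) * a (s, d) = -(a (r, d) * a (s, c)) := eq_neg_of_add_eq_zero_left hs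
        have e2 : a (r, c) * a (t, d) = -(a (r, d) * a (t, c)) := eq_neg_of_add_eq_zero_left ht
        linear_combination a (s, c) * e2 + a (t, c) * e1
      rw [hst', mul_zero] at key
      have h0 : 2 * (a (r, d) * a (s, c)) * a (t, c) = 0 := neg_eq_zero.1 key.symm
      rcases mul_eq_zero.1 h0 with h | h
      · rcases mul_eq_zero.1 h with h' | h'
        · exact h2 h'
        · exact (mul_ne_zero hd hsc) h'
      · exact htc h
    by_cases hdead : ∀ s, s ≠ r → a (s, c) = 0
    · exact Or.inl ⟨r, fun s j hsr => rowA s hsr (hdead s hsr) j⟩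
    · push Not at hdead
      obtain ⟨s, hsr, hsc⟩ := hdead
      refine Or.inr (Or.inr ⟨r, s, c, d, Ne.symm hsr, Ne.symm hdc, hc, fun i j hij => ⟨?_, ?_⟩⟩)
      · by_contra hi
        push Not at hi
        have hic : a (i, c) = 0 := by
          by_contra hic
          exact twoLive s i hsr hi.1 (Ne.symm hi.2) hsc hic
        exact hij (rowA i hi.1 hic j)
      · by_contra hj
        push Not at hj
        rcases eq_or_ne i r with hir | hir
        · rw [hir] at hij
          exact hij (rowB s hsr hsc j hj.1 hj.2).1
        · by_cases hic : a (i, c) = 0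
          · exact hij (rowA i hir hic j)
          · exact hij (rowB i hir hic j hj.1 hj.2).2

variable {K : Type*} [Field K] [Algebra K L]

/-- **The type (3) count at a point**: if `a` vanishes off the block `{r, s} × {c, d}`
(`r ≠ s`, `c ≠ d`), the block permanent `a_{rc} a_{sd} + a_{rd} a_{sc}` vanishes and
`a_{rc} ≠ 0`, then `{f : f(a) = 0}` has height `≥ mn − 3`: the `mn − 4` vanishing coordinates, and
the block permanent frees `a_{sd}` as one more strict step of the chain (LS Rem. 4.2: "type (3)
primes have height `mn − 4 + 1 = mn − 3`"). [cite: LaubenbacherSwanson2000, Rem. 4.2 (arXiv text p0006 L107–112)] -/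
theorem blockStep_height_ge {m n : ℕ} (a : Fin m × Fin n → L) {r s : Fin m} {c d : Fin n} (hrs : r ≠ s)
    (hcd : c ≠ d) (hrc : a (r, c) ≠ 0)
    (hoff : ∀ x : Fin m × Fin n, ¬((x.1 = r ∨ x.1 = s) ∧ (x.2 = c ∨ x.2 = d)) → a x = 0)
    (hper : a (r, c) * a (s, d) + a (r, d) * a (s, c) = 0) :
    ((m * n - 3 : ℕ) : ℕ∞) ≤ (RingHom.ker (aeval (R := K) a)).height := by
  classical
  set T₀ : Finset (Fin m × Fin n) :=
    Finset.univ.filter fun x => ¬((x.1 = r ∨ x.1 = s) ∧ (x.2 = c ∨ x.2 = d)) with hT₀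
  have hmemT₀ : ∀ x, x ∈ T₀ ↔ ¬((x.1 = r ∨ x.1 = s) ∧ (x.2 = c ∨ x.2 = d)) := fun x => by
    rw [hT₀, Finset.mem_filter]
    exact ⟨fun h => h.2, fun h => ⟨Finset.mem_univ _, h⟩⟩
  have hT₀zero : ∀ x ∈ T₀, a x = 0 := fun x hx => hoff x ((hmemT₀ x).1 hx)
  have hT₀card : m * n - 4 ≤ T₀.card := by
    have hB : (Finset.univ.filter fun x : Fin m × Fin n =>
        (x.1 = r ∨ x.1 = s) ∧ (x.2 = c ∨ x.2 = d)).card ≤ 4 := by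
      calc (Finset.univ.filter fun x : Fin m × Fin n =>
            (x.1 = r ∨ x.1 = s) ∧ (x.2 = c ∨ x.2 = d)).card
          ≤ (({r, s} : Finset (Fin m)) ×ˢ ({c, d} : Finset (Fin n))).card :=
            Finset.card_le_card fun x hx => by
              have hx' := (Finset.mem_filter.1 hx).2
              simp only [Finset.mem_product, Finset.mem_insert, Finset.mem_singleton]
              exact hx'
        _ ≤ 2 * 2 := by
            rw [Finset.card_product]
            exact Nat.mul_le_mul Finset.card_le_two Finset.card_le_two
    have hsum := Finset.card_filter_add_card_filter_not
      (s := (Finset.univ : Finset (Fin m × Fin n)))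
      (p := fun x : Fin m × Fin n => (x.1 = r ∨ x.1 = s) ∧ (x.2 = c ∨ x.2 = d))
    rw [Finset.card_univ, Fintype.card_prod, Fintype.card_fin, Fintype.card_fin] at hsum
    rw [hT₀]
    omega
  -- no position of the block is in `T₀`
  have hfree : ∀ x ∈ T₀, x.1 ∈ insert s ({r} : Finset (Fin m)) →
      x.2 ∈ insert d ({c} : Finset (Fin n)) → False := by
    intro x hx h1 h2
    simp only [Finset.mem_insert, Finset.mem_singleton] at h1 h2
    exact (hmemT₀ x).1 hx ⟨h1.symm, h2.symm⟩
  have hz := height_ker_aeval_piecewise_add_card_le (K := K) a T₀ hT₀zero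
  have hsr' : s ∉ ({r} : Finset (Fin m)) := by simpa using hrs.symm
  have hdc' : d ∉ ({c} : Finset (Fin n)) := by simpa using hcd.symm
  have hstep := height_ker_aeval_piecewise_insert (K := K) a T₀ (s, d)
    (rsubperm (mvPolynomialX (Fin m) (Fin n) K) (· ∈ insert d ({c} : Finset (Fin n)))
      (· ∈ insert s ({r} : Finset (Fin m)))) ?_ ?_
  rotate_left
  · rw [aeval_rowWitness_of_notMem a (fun x hx h1 h2 => hfree x hx h1 h2),
      rsubperm_pair _ hrs.symm hcd.symm, map_eq_zero_iff _ (C_injective _ _)]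
    simp only [Matrix.of_apply]
    linear_combination hper
  · rw [aeval_rowWitness_of_mem a hsr' hdc' (T := insert (s, d) T₀)
      (fun x hx h1 h2 => ?_) (Finset.mem_insert_self _ _), rsubperm_singleton,
      Matrix.of_apply]
    · exact X_mul_C_add_C_ne_zero hrc
    · rcases Finset.mem_insert.1 hx with h | h
      · exact h
      · exact (hfree x h h1 h2).elim
  have h1' : (1 : ℕ∞) ≤ (RingHom.ker (aeval (R := K)
      (T₀.piecewise X (C ∘ a) : Fin m × Fin n → MvPolynomial (Fin m × Fin n) L))).height :=
    le_add_self.trans hstep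
  have htot := (add_le_add h1' le_rfl).trans hz
  rw [ker_aeval_piecewise_empty] at htot
  refine le_trans ?_ htot
  have hle : m * n - 3 ≤ 1 + T₀.card := by omega
  exact_mod_cast hle

/-- **The three heights of Remark 4.2 as lower bounds at a point**: if all `2 × 2` permanents of
an `m × n` matrix `a` over a domain `L ⊇ K` vanish (`m, n ≥ 2`, `max(m,n) ≥ 3`, `2 ≠ 0` in `K`),
then the prime `{f : f(a) = 0} ⊆ K[X_{m×n}]` has height `≥ mn − max(m, n)`: by the support
trichotomy the coordinates vanishing at `a` number at least `(m−1)n`, `m(n−1)`, or `mn − 4`, and in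
the last case the block permanent `a_{rc} a_{sd} + a_{rd} a_{sc} = 0` frees `a_{sd}` as one more
strict step of the chain (`mn − 3`; LS Rem. 4.2: "Primes of type (1) have height `(m−1)n`, those
of type (2) have height `m(n−1)`, and type (3) primes have height `mn − 3`").
[cite: LaubenbacherSwanson2000, Rem. 4.2 (arXiv text p0006 L107–112)] -/
theorem height_ker_aeval_ge_of_twoSubperm (h2 : (2 : K) ≠ 0) {m n : ℕ} (hm : 2 ≤ m)
    (hn : 2 ≤ n) (h3 : 3 ≤ max m n) (a : Fin m × Fin n → L)
    (hvan : ∀ (r s : Fin m) (i j : Fin n), r ≠ s → i ≠ j →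
      a (r, i) * a (s, j) + a (r, j) * a (s, i) = 0) :
    ((m * n - max m n : ℕ) : ℕ∞) ≤ (RingHom.ker (aeval (R := K) a)).height := by
  classical
  have h2L : (2 : L) ≠ 0 := fun h =>
    h2 ((algebraMap K L).injective (by rw [map_ofNat, map_zero]; exact h))
  have zeros : ∀ T : Finset (Fin m × Fin n), (∀ x ∈ T, a x = 0) →
      (T.card : ℕ∞) ≤ (RingHom.ker (aeval (R := K) a)).height :=
    fun T hT => card_le_height_ker_aeval a T hT
  have hmax1 : m * n - max m n ≤ (m - 1) * n := by
    rw [Nat.sub_one_mul]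
    exact Nat.sub_le_sub_left (le_max_right m n) _
  have hmax2 : m * n - max m n ≤ m * (n - 1) := by
    rw [Nat.mul_sub_one]
    exact Nat.sub_le_sub_left (le_max_left m n) _
  have hmax3 : m * n - max m n ≤ m * n - 3 := Nat.sub_le_sub_left h3 _
  rcases support_trichotomy h2L (by omega) (by omega) a hvan with
    ⟨r, hr⟩ | ⟨c, hc⟩ | ⟨r, s, c, d, hrs, hcd, hrc, hblk⟩
  · -- one row: `(m-1) n` vanishing coordinates
    refine le_trans ?_ (zeros ((Finset.univ.erase r) ×ˢ Finset.univ) ?_)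
    · rw [Finset.card_product, Finset.card_erase_of_mem (Finset.mem_univ _), Finset.card_univ,
        Fintype.card_fin, Finset.card_univ, Fintype.card_fin]
      exact_mod_cast hmax1
    · rintro ⟨s, j⟩ hx
      exact hr s j (Finset.ne_of_mem_erase (Finset.mem_product.1 hx).1)
  · -- one column: `m (n-1)` vanishing coordinates
    refine le_trans ?_ (zeros (Finset.univ ×ˢ (Finset.univ.erase c)) ?_)
    · rw [Finset.card_product, Finset.card_erase_of_mem (Finset.mem_univ _), Finset.card_univ,
        Fintype.card_fin, Finset.card_univ, Fintype.card_fin]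
      exact_mod_cast hmax2
    · rintro ⟨i, e⟩ hx
      exact hc i e (Finset.ne_of_mem_erase (Finset.mem_product.1 hx).2)
  · -- a `2 × 2` block: `mn - 4` vanishing coordinates and one relation
    refine le_trans (by exact_mod_cast hmax3) (blockStep_height_ge (K := K) a hrs hcd hrc
      (fun x hx => ?_) (hvan r s c d hrs hcd))
    by_contra h
    exact hx (hblk x.1 x.2 h)

end Pointwise

/-! ### §C. Theorem 4.1 (first half) and the height of `P₂(M)` -/

section Ideal

variable (F : Type*) [Field F]

/-- **Laubenbacher–Swanson 2000, Theorem 4.1, first half** ("Let `m, n ≥ 2`.  Each of the prime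
ideals `P` of `R` minimal over `P₂(M)` is one of the following: (1) if `n ≥ 3`, then `P` is
generated by all the indeterminates in `m − 1` of the rows of `M`; (2) if `m ≥ 3`, then `P` is
generated by all the indeterminates in `n − 1` of the columns of `M`; (3) `P` is generated by the
permanent of one `2 × 2`-submatrix of `M` and all the entries of `M` outside of this
submatrix."), in containment form over a field with `2 ≠ 0` and `m, n ≥ 1`: every prime
`P ⊇ P₂(M)` contains the variables off some row, or off some column, or off some `2 × 2` block
`{r, s} × {c, d}` together with that block's permanent (and then `x_{rc} ∉ P`).  The side
conditions "if `n ≥ 3`" / "if `m ≥ 3`" and "Moreover, each of the primes in (1), (2) and (3) is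
minimal over `P₂(M)`" concern minimality and are NOT typed.
[cite: LaubenbacherSwanson2000, Thm. 4.1 (arXiv text p0006 L9–22)] -/
theorem thm_4_1_contains (h2 : (2 : F) ≠ 0) {m n : ℕ} (hm : 1 ≤ m) (hn : 1 ≤ n)
    (P : Ideal (MvPolynomial (Fin m × Fin n) F)) [P.IsPrime] (hP : subpermIdeal F m n 2 ≤ P) :
    (∃ r : Fin m, ∀ s j, s ≠ r → (X (s, j) : MvPolynomial (Fin m × Fin n) F) ∈ P) ∨
    (∃ c : Fin n, ∀ i d, d ≠ c → (X (i, d) : MvPolynomial (Fin m × Fin n) F) ∈ P) ∨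
    (∃ (r s : Fin m) (c d : Fin n), r ≠ s ∧ c ≠ d ∧ X (r, c) ∉ P ∧
      (∀ i j, ¬((i = r ∨ i = s) ∧ (j = c ∨ j = d)) →
        (X (i, j) : MvPolynomial (Fin m × Fin n) F) ∈ P) ∧
      (X (r, c) * X (s, d) + X (r, d) * X (s, c) : MvPolynomial (Fin m × Fin n) F) ∈ P) := by
  classical
  let a : Fin m × Fin n → MvPolynomial (Fin m × Fin n) F ⧸ P := fun x => Ideal.Quotient.mk P (X x)
  have ha : ∀ x, a x = 0 ↔ (X x : MvPolynomial (Fin m × Fin n) F) ∈ P := fun x =>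
    Ideal.Quotient.eq_zero_iff_mem
  have hker := ker_aeval_quotientMk (K := F) P
  have hvan : ∀ (r s : Fin m) (i j : Fin n), r ≠ s → i ≠ j →
      a (r, i) * a (s, j) + a (r, j) * a (s, i) = 0 := by
    intro r s i j hrs hij
    have hmem := hP (pair_mem_subpermIdeal_two F hrs hij)
    rw [← hker, RingHom.mem_ker] at hmem
    simpa only [map_add, map_mul, aeval_X] using hmem
  have h2P : (2 : MvPolynomial (Fin m × Fin n) F ⧸ P) ≠ 0 := fun h =>
    h2 ((algebraMap F (MvPolynomial (Fin m × Fin n) F ⧸ P)).injective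
      (by rw [map_ofNat, map_zero]; exact h))
  rcases support_trichotomy h2P hm hn a hvan with
    ⟨r, hr⟩ | ⟨c, hc⟩ | ⟨r, s, c, d, hrs, hcd, hrc, hblk⟩
  · exact Or.inl ⟨r, fun s j hsr => (ha _).1 (hr s j hsr)⟩
  · exact Or.inr (Or.inl ⟨c, fun i d hdc => (ha _).1 (hc i d hdc)⟩)
  · refine Or.inr (Or.inr ⟨r, s, c, d, hrs, hcd, fun h => hrc ((ha _).2 h), fun i j hij => ?_,
      hP (pair_mem_subpermIdeal_two F hrs hcd)⟩)
    by_contra h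
    exact hij (hblk i j (fun h0 => h ((ha _).1 h0)))

/-- **Lower bound at every prime**: for `m, n ≥ 2`, `max(m, n) ≥ 3` and `2 ≠ 0` in `F`, every prime
of `F[X_{m×n}]` containing `P₂(M)` has height `≥ mn − max(m, n)` (the least of the three heights
of Remark 4.2). [cite: LaubenbacherSwanson2000, Thm. 4.1 and Rem. 4.2 (arXiv text p0006 L9–22, L107–112)] -/
theorem height_ge_of_subpermIdeal_two_le (h2 : (2 : F) ≠ 0) {m n : ℕ} (hm : 2 ≤ m) (hn : 2 ≤ n)
    (h3 : 3 ≤ max m n) (P : Ideal (MvPolynomial (Fin m × Fin n) F)) [P.IsPrime]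
    (hP : subpermIdeal F m n 2 ≤ P) : ((m * n - max m n : ℕ) : ℕ∞) ≤ P.height := by
  classical
  let a : Fin m × Fin n → MvPolynomial (Fin m × Fin n) F ⧸ P := fun x => Ideal.Quotient.mk P (X x)
  have hker := ker_aeval_quotientMk (K := F) P
  have hvan : ∀ (r s : Fin m) (i j : Fin n), r ≠ s → i ≠ j →
      a (r, i) * a (s, j) + a (r, j) * a (s, i) = 0 := by
    intro r s i j hrs hij
    have hmem := hP (pair_mem_subpermIdeal_two F hrs hij)
    rw [← hker, RingHom.mem_ker] at hmem
    simpa only [map_add, map_mul, aeval_X] using hmem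
  rw [← hker]
  exact height_ker_aeval_ge_of_twoSubperm h2 hm hn h3 a hvan

/-- Krull's height theorem, packaged: an ideal inside a proper ideal generated by the finite set
`T` has height `≤ |T|`. [folklore] -/
private theorem height_le_card_of_le_span' {A : Type*} [CommRing A] [IsNoetherianRing A]
    {I : Ideal A} {T : Finset A} (hle : I ≤ Ideal.span (T : Set A))
    (hT : Ideal.span (T : Set A) ≠ ⊤) : I.height ≤ T.card := by
  obtain ⟨p, hp⟩ := Ideal.nonempty_minimalPrimes hT
  exact (Ideal.height_mono (hle.trans hp.1.2)).trans
    (Ideal.height_le_card_of_mem_minimalPrimes_span_finset hp)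

/-- An ideal generated by variables is proper. [folklore] -/
private theorem span_X_ne_top {σ : Type*} (S : Set σ) :
    Ideal.span ((fun x => (X x : MvPolynomial σ F)) '' S) ≠ ⊤ := by
  have hle : Ideal.span ((fun x => (X x : MvPolynomial σ F)) '' S) ≤
      RingHom.ker (constantCoeff : MvPolynomial σ F →+* F) := by
    rw [Ideal.span_le]
    rintro g ⟨x, -, rfl⟩
    rw [SetLike.mem_coe, RingHom.mem_ker]
    exact constantCoeff_X F x
  exact fun htop => RingHom.ker_ne_top _ (top_le_iff.1 (htop ▸ hle))

variable {F} in
/-- `P₂(M)` lies in the ideal of the variables at a set of positions `S` which meets both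
monomials of every `2 × 2` permanent: if for all `r ≠ s` and `i ≠ j` one of `(r,i), (s,j)` and
one of `(r,j), (s,i)` lies in `S`, then `P₂(M) ≤ (x_p : p ∈ S)`. [folklore] -/
private theorem subpermIdeal_two_le_span {m n : ℕ} (S : Set (Fin m × Fin n))
    (hS : ∀ (r s : Fin m) (i j : Fin n), r ≠ s → i ≠ j →
      ((r, i) ∈ S ∨ (s, j) ∈ S) ∧ ((r, j) ∈ S ∨ (s, i) ∈ S)) :
    subpermIdeal F m n 2 ≤
      Ideal.span ((fun x => (X x : MvPolynomial (Fin m × Fin n) F)) '' S) := by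
  classical
  have hX : ∀ x ∈ S, (X x : MvPolynomial (Fin m × Fin n) F) ∈
      Ideal.span ((fun x => (X x : MvPolynomial (Fin m × Fin n) F)) '' S) :=
    fun x hx => Ideal.subset_span ⟨x, hx, rfl⟩
  have hmono : ∀ x y : Fin m × Fin n, x ∈ S ∨ y ∈ S →
      (X x * X y : MvPolynomial (Fin m × Fin n) F) ∈
        Ideal.span ((fun x => (X x : MvPolynomial (Fin m × Fin n) F)) '' S) := by
    rintro x y (h | h)
    · exact Ideal.mul_mem_right _ _ (hX x h)
    · exact Ideal.mul_mem_left _ _ (hX y h)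
  refine subpermIdeal_le_iff.2 fun Rw Cl hR hC => ?_
  obtain ⟨r, s, hrs, rfl⟩ := Finset.card_eq_two.1 hR
  obtain ⟨i, j, hij, rfl⟩ := Finset.card_eq_two.1 hC
  rw [rsubperm_pair _ hrs hij]
  simp only [Matrix.mvPolynomialX_apply]
  obtain ⟨h₁, h₂⟩ := hS r s i j hrs hij
  exact Ideal.add_mem _ (hmono _ _ h₁) (hmono _ _ h₂)

variable {F} in
/-- Height bound by the variables at a finite set of positions. [folklore] -/
private theorem height_le_card_of_le_span_X {m n : ℕ} {I : Ideal (MvPolynomial (Fin m × Fin n) F)}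
    (S : Finset (Fin m × Fin n))
    (hle : I ≤ Ideal.span ((fun x => (X x : MvPolynomial (Fin m × Fin n) F)) '' (S : Set _))) :
    I.height ≤ S.card := by
  classical
  have hco : ((S.image fun x => (X x : MvPolynomial (Fin m × Fin n) F)) : Set _) =
      (fun x => (X x : MvPolynomial (Fin m × Fin n) F)) '' (S : Set _) := Finset.coe_image
  have hle' : I ≤ Ideal.span ((S.image fun x => (X x : MvPolynomial (Fin m × Fin n) F)) :
      Set (MvPolynomial (Fin m × Fin n) F)) := by rwa [hco]
  have hne : Ideal.span ((S.image fun x => (X x : MvPolynomial (Fin m × Fin n) F)) :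
      Set (MvPolynomial (Fin m × Fin n) F)) ≠ ⊤ := by
    rw [hco]; exact span_X_ne_top F _
  refine (height_le_card_of_le_span' hle' hne).trans ?_
  exact_mod_cast Finset.card_image_le

/-- **Upper bound by a row type ideal** (Rem. 4.2, type (1)): `P₂(M)` lies in the ideal of the
`(m−1)n` variables off the row `r` (every `2 × 2` permanent uses a second row), so
`ht P₂(M) ≤ (m−1)n` (Krull). [cite: LaubenbacherSwanson2000, Rem. 4.2 (arXiv text p0006 L107–112)] -/
theorem height_subpermIdeal_two_le_rows {m n : ℕ} (r : Fin m) :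
    (subpermIdeal F m n 2).height ≤ ((m - 1) * n : ℕ) := by
  classical
  let S : Finset (Fin m × Fin n) := (Finset.univ.erase r) ×ˢ Finset.univ
  have hS : ∀ x : Fin m × Fin n, x ∈ (S : Set (Fin m × Fin n)) ↔ x.1 ≠ r := fun x => by
    simp only [S, Finset.mem_coe, Finset.mem_product, Finset.mem_erase, Finset.mem_univ,
      and_true, ne_eq]
  have hle := subpermIdeal_two_le_span (F := F) (S : Set (Fin m × Fin n))
    fun r' s i j hrs _ => by
      simp only [hS]
      by_cases h : r' = r
      · exact ⟨Or.inr fun hs => hrs (h.trans hs.symm), Or.inr fun hs => hrs (h.trans hs.symm)⟩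
      · exact ⟨Or.inl h, Or.inl h⟩
  refine (height_le_card_of_le_span_X S hle).trans (le_of_eq ?_)
  simp only [S, Finset.card_product, Finset.card_erase_of_mem (Finset.mem_univ _),
    Finset.card_univ, Fintype.card_fin]

/-- **Upper bound by a column type ideal** (Rem. 4.2, type (2)): `ht P₂(M) ≤ m(n−1)`.
[cite: LaubenbacherSwanson2000, Rem. 4.2 (arXiv text p0006 L107–112)] -/
theorem height_subpermIdeal_two_le_cols {m n : ℕ} (c : Fin n) :
    (subpermIdeal F m n 2).height ≤ ((m * (n - 1)) : ℕ) := by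
  classical
  let S : Finset (Fin m × Fin n) := Finset.univ ×ˢ (Finset.univ.erase c)
  have hS : ∀ x : Fin m × Fin n, x ∈ (S : Set (Fin m × Fin n)) ↔ x.2 ≠ c := fun x => by
    simp only [S, Finset.mem_coe, Finset.mem_product, Finset.mem_erase, Finset.mem_univ,
      true_and, and_true, ne_eq]
  have hle := subpermIdeal_two_le_span (F := F) (S : Set (Fin m × Fin n))
    fun r s i j _ hij => by
      simp only [hS]
      by_cases hi : i = c
      · exact ⟨Or.inr fun hj => hij (hi.trans hj.symm), Or.inl fun hj => hij (hi.trans hj.symm)⟩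
      · exact ⟨Or.inl hi, Or.inr hi⟩
  refine (height_le_card_of_le_span_X S hle).trans (le_of_eq ?_)
  simp only [S, Finset.card_product, Finset.card_erase_of_mem (Finset.mem_univ _),
    Finset.card_univ, Fintype.card_fin]

/-- A lower bound valid for every prime over `I` bounds the height of `I`. [folklore] -/
private theorem le_height_of_forall_isPrime'' {A : Type*} [CommRing A] {I : Ideal A} {c : ℕ∞}
    (h : ∀ P : Ideal A, P.IsPrime → I ≤ P → c ≤ P.height) : c ≤ I.height := by
  rw [Ideal.height_eq_inf_minimalPrimes]
  exact le_iInf₂ fun P hP => h P hP.1.1 hP.1.2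

/-- **Laubenbacher–Swanson 2000, the height of `P₂(M)`** (Thm. 4.1 with Rem. 4.2: the minimal
primes over `P₂(M)` have heights `(m−1)n` (type 1, `n ≥ 3`), `m(n−1)` (type 2, `m ≥ 3`), `mn − 3`
(type 3)): for `m, n ≥ 2` with `max(m, n) ≥ 3` over a field with `2 ≠ 0`,
`ht P₂(M) = mn − max(m, n)` (`= min{(m−1)n, m(n−1), mn−3}`).  Typed from the FIRST half of
Thm. 4.1 only (containment) plus the two variable-type upper bounds; for `m = n = 2`, `P₂(M)` is
principal of height `1` (not covered).  Instances in the tree: `thm_2_1_height` (BCMV Thm. 2.1,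
`m = 2`), `height_subpermIdeal_three_three_two` (`3 × 3`).
[cite: LaubenbacherSwanson2000, Thm. 4.1 and Rem. 4.2 (arXiv text p0006 L9–22, L107–112)] -/
theorem height_subpermIdeal_two (h2 : (2 : F) ≠ 0) {m n : ℕ} (hm : 2 ≤ m) (hn : 2 ≤ n)
    (h3 : 3 ≤ max m n) : (subpermIdeal F m n 2).height = (m * n - max m n : ℕ) := by
  apply le_antisymm
  · rcases le_total m n with h | h
    · have hr := height_subpermIdeal_two_le_rows F (m := m) (n := n) ⟨0, by omega⟩
      rw [max_eq_right h]
      rwa [Nat.sub_one_mul, show m * n - n = m * n - n from rfl] at hr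
    · have hc := height_subpermIdeal_two_le_cols F (m := m) (n := n) ⟨0, by omega⟩
      rw [max_eq_left h]
      rwa [Nat.mul_sub_one] at hc
  · exact le_height_of_forall_isPrime'' fun P hP hle => by
      haveI := hP
      exact height_ge_of_subpermIdeal_two_le F h2 hm hn h3 P hle

/-- **BCMV Thm. 2.1's height clause as an instance** (`m = 2`, `n ≥ 3`): `ht P₂(2 × n) = n`
(the tree's `BoraleviCarliniMichalekVentura2025.thm_2_1_height`, re-derived from
`height_subpermIdeal_two`; not a restatement of new content). [cite: LaubenbacherSwanson2000, Thm. 4.1 and Rem. 4.2 (arXiv text p0006 L9–22, L107–112)] -/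
theorem thm_2_1_height_of_LS (h2 : (2 : F) ≠ 0) {n : ℕ} (hn : 3 ≤ n) :
    (subpermIdeal F 2 n 2).height = n := by
  rw [height_subpermIdeal_two F h2 le_rfl (by omega) (hn.trans (le_max_right 2 n)),
    max_eq_right (by omega : 2 ≤ n)]
  congr 1
  omega

/-- **`codim Sing(perm_3) = 6` as an instance** (`m = n = 3`): `ht P₂(3 × 3) = 9 − 3 = 6` (the
tree's `BoraleviCarliniMichalekVentura2025.height_subpermIdeal_three_three_two`, file
`ABV17SingPermThreeCodim`, re-derived from `height_subpermIdeal_two`). [cite: LaubenbacherSwanson2000, Thm. 4.1 and Rem. 4.2 (arXiv text p0006 L9–22, L107–112)] -/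
theorem height_subpermIdeal_three_three_two_of_LS (h2 : (2 : F) ≠ 0) :
    (subpermIdeal F 3 3 2).height = 6 := by
  rw [height_subpermIdeal_two F h2 (by norm_num) (by norm_num) (by norm_num), max_self]
  norm_num

/-! ### §D. Remark 4.2: the heights of the three types of ideals -/

variable {F} in
/-- The ideal of the variables at a finite set `S` of positions has height `|S|` (upper bound:
Krull; lower bound: these coordinates vanish at the generic point of any prime over it). [folklore] -/
private theorem height_span_X_eq_card {m n : ℕ} (S : Finset (Fin m × Fin n)) :
    (Ideal.span ((fun x => (X x : MvPolynomial (Fin m × Fin n) F)) '' (S : Set _))).height =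
      S.card := by
  classical
  apply le_antisymm
  · exact height_le_card_of_le_span_X S le_rfl
  · refine le_height_of_forall_isPrime'' fun P hP hle => ?_
    haveI := hP
    let a : Fin m × Fin n → MvPolynomial (Fin m × Fin n) F ⧸ P :=
      fun x => Ideal.Quotient.mk P (X x)
    have hker := ker_aeval_quotientMk (K := F) P
    rw [← hker]
    refine card_le_height_ker_aeval a S fun x hx => ?_
    exact Ideal.Quotient.eq_zero_iff_mem.2 (hle (Ideal.subset_span ⟨x, Finset.mem_coe.2 hx, rfl⟩))

/-- **Laubenbacher–Swanson 2000, Remark 4.2, type (1)** ("Primes of type (1) have height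
`(m−1)n`"): the ideal generated by the variables off the row `r` has height `(m−1)n`.
[cite: LaubenbacherSwanson2000, Rem. 4.2 (arXiv text p0006 L107–112)] -/
theorem rem_4_2_rows {m n : ℕ} (r : Fin m) :
    (Ideal.span ((fun x => (X x : MvPolynomial (Fin m × Fin n) F)) '' {x | x.1 ≠ r})).height =
      ((m - 1) * n : ℕ) := by
  classical
  let S : Finset (Fin m × Fin n) := (Finset.univ.erase r) ×ˢ Finset.univ
  have hS : ({x | x.1 ≠ r} : Set (Fin m × Fin n)) = (S : Set (Fin m × Fin n)) := by
    ext x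
    simp only [S, Set.mem_setOf_eq, Finset.coe_product, Finset.coe_erase, Finset.coe_univ,
      Set.mem_prod, Set.mem_sdiff, Set.mem_univ, Set.mem_singleton_iff, true_and, and_true]
  have hcard : S.card = (m - 1) * n := by
    simp only [S, Finset.card_product, Finset.card_erase_of_mem (Finset.mem_univ _),
      Finset.card_univ, Fintype.card_fin]
  rw [hS, height_span_X_eq_card, hcard]

/-- **Laubenbacher–Swanson 2000, Remark 4.2, type (2)** ("those of type (2) have height
`m(n−1)`"): the ideal generated by the variables off the column `c` has height `m(n−1)`.
[cite: LaubenbacherSwanson2000, Rem. 4.2 (arXiv text p0006 L107–112)] -/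
theorem rem_4_2_cols {m n : ℕ} (c : Fin n) :
    (Ideal.span ((fun x => (X x : MvPolynomial (Fin m × Fin n) F)) '' {x | x.2 ≠ c})).height =
      ((m * (n - 1)) : ℕ) := by
  classical
  let S : Finset (Fin m × Fin n) := Finset.univ ×ˢ (Finset.univ.erase c)
  have hS : ({x | x.2 ≠ c} : Set (Fin m × Fin n)) = (S : Set (Fin m × Fin n)) := by
    ext x
    simp only [S, Set.mem_setOf_eq, Finset.coe_product, Finset.coe_erase, Finset.coe_univ,
      Set.mem_prod, Set.mem_sdiff, Set.mem_univ, Set.mem_singleton_iff, true_and]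
  have hcard : S.card = m * (n - 1) := by
    simp only [S, Finset.card_product, Finset.card_erase_of_mem (Finset.mem_univ _),
      Finset.card_univ, Fintype.card_fin]
  rw [hS, height_span_X_eq_card, hcard]

/-- **Laubenbacher–Swanson 2000, Remark 4.2, type (3), lower bound** ("type (3) primes have
height `mn − 4 + 1 = mn − 3`"): every prime containing the variables off a `2 × 2` block
`{r, s} × {c, d}` and that block's permanent has height `≥ mn − 3` (any field; no hypothesis on
`2`).  The exact value `mn − 3` and the primality of the type (3) ideal are NOT typed.
[cite: LaubenbacherSwanson2000, Rem. 4.2 (arXiv text p0006 L107–112)] -/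
theorem rem_4_2_block_ge {m n : ℕ} {r s : Fin m} {c d : Fin n} (hrs : r ≠ s) (hcd : c ≠ d)
    (P : Ideal (MvPolynomial (Fin m × Fin n) F)) [P.IsPrime]
    (hoff : ∀ x : Fin m × Fin n, ¬((x.1 = r ∨ x.1 = s) ∧ (x.2 = c ∨ x.2 = d)) →
      (X x : MvPolynomial (Fin m × Fin n) F) ∈ P)
    (hper : (X (r, c) * X (s, d) + X (r, d) * X (s, c) : MvPolynomial (Fin m × Fin n) F) ∈ P) :
    ((m * n - 3 : ℕ) : ℕ∞) ≤ P.height := by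
  classical
  let a : Fin m × Fin n → MvPolynomial (Fin m × Fin n) F ⧸ P := fun x => Ideal.Quotient.mk P (X x)
  have hker := ker_aeval_quotientMk (K := F) P
  have hoff' : ∀ x : Fin m × Fin n, ¬((x.1 = r ∨ x.1 = s) ∧ (x.2 = c ∨ x.2 = d)) → a x = 0 :=
    fun x hx => Ideal.Quotient.eq_zero_iff_mem.2 (hoff x hx)
  have hper' : a (r, c) * a (s, d) + a (r, d) * a (s, c) = 0 := by
    have h := (Ideal.Quotient.eq_zero_iff_mem (I := P)).2 hper
    simpa only [map_add, map_mul] using h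
  rw [← hker]
  by_cases hrc : a (r, c) ≠ 0
  · exact blockStep_height_ge (K := F) a hrs hcd hrc hoff' hper'
  by_cases hrd : a (r, d) ≠ 0
  · exact blockStep_height_ge (K := F) a hrs hcd.symm hrd
      (fun x hx => hoff' x fun h => hx ⟨h.1, h.2.symm⟩) (by linear_combination hper')
  by_cases hsc : a (s, c) ≠ 0
  · exact blockStep_height_ge (K := F) a hrs.symm hcd hsc
      (fun x hx => hoff' x fun h => hx ⟨h.1.symm, h.2⟩) (by linear_combination hper')
  by_cases hsd : a (s, d) ≠ 0
  · exact blockStep_height_ge (K := F) a hrs.symm hcd.symm hsd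
      (fun x hx => hoff' x fun h => hx ⟨h.1.symm, h.2.symm⟩) (by linear_combination hper')
  push Not at hrc hrd hsc hsd
  -- the whole matrix vanishes: `mn` vanishing coordinates
  have hall : ∀ x, a x = 0 := by
    rintro ⟨i, j⟩
    by_cases h : (i = r ∨ i = s) ∧ (j = c ∨ j = d)
    · rcases h with ⟨h1 | h1, h2 | h2⟩ <;> (rw [h1, h2]; assumption)
    · exact hoff' (i, j) h
  refine le_trans ?_ (card_le_height_ker_aeval a Finset.univ fun x _ => hall x)
  rw [Finset.card_univ, Fintype.card_prod, Fintype.card_fin, Fintype.card_fin]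
  exact_mod_cast Nat.sub_le _ _

end Ideal

end LaubenbacherSwanson2000

end Literature.Computability.AlgebraicComplexity
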